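import Summits.ValiantsHypothesis.ValiantsHypothesis.Theses.SymPencil
import Literature.Computability.AlgebraicComplexity.HessianRank

/-!
# Route SymPencil — item `HessianRankSymmDet` (stmt-ValiantsHypothesis-5677)

**The symmetric Mignon–Ressayre lemma.** If `f = det A` for a *symmetric* `m × m` matrix `A` of
affine linear forms over `ℂ` and `f(x) = 0`, then `rank Hess f (x) ≤ m + 1` (the general, not
necessarily symmetric, bound of Mignon–Ressayre 2004, §3 is `2 m`, in tree as
`Literature.Computability.AlgebraicComplexity.rank_hessianMatrix_le_two_mul_of_isAffineDetRepr`).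

## Proof (coordinate-free, no congruence normal form)

By the affine chain rule (`hessianMatrix_aeval_of_affine`, tree) `Hess f (x) = Lᵀ · H · L` with
`H = Hess DET_m (Y)`, `Y = A(x)` a *symmetric singular* matrix, and the columns of `L` (the linear
parts `(∂ᵥ A_{ij})(x)` of the entries) *symmetric* matrices. Let `w ≠ 0` with `Y w = 0 = wᵀ Y`.

* `dotProduct_hessianMatrix_detPoly_mulVec_swap`: the pairing `Z₁ᵀ · Hess DET (Y) · Z₂` is
  invariant under transposing `Y, Z₁, Z₂` (`det` is transpose-invariant), so the tree's vanishing
  lemma `dotProduct_hessianMatrix_detPoly_mulVec_eq_zero` (common LEFT null vector) also holds for a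
  common RIGHT null vector;
* `dotProduct_hessianMatrix_detPoly_mulVec_eq_zero_of_two_sided`: hence `Zᵀ H Z' = 0` whenever
  `wᵀ Z = 0`, `Z w = 0` and `wᵀ Z' w = 0` — split `Z' = (Z' - Π Z') + Π Z'` with
  `wᵀ (Z' - Π Z') = 0` and `(Π Z') w = e_{i₀} (wᵀ Z' w) / w_{i₀} = 0`;
* `rank_transpose_mul_mul_le_card_add_one`: abstract linear algebra — if a square matrix `H` on
  `ι × ι` kills all such pairs `(Z, Z')`, then `rank (Lᵀ H L) ≤ |ι| + 1` for every `L` with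
  symmetric columns: with the rank-`≤ |ι|` map `R Z = u (wᵀZ) + (wᵀZ)ᵀ uᵀ - (wᵀ Z w) u uᵀ`
  (`u = e_{i₀} / w_{i₀}`; it factors through `Z ↦ wᵀ Z`) every symmetric `Z` has `Z - R Z`
  two-sided `w`-orthogonal, so `Lᵀ H L = (R L)ᵀ H L + a ⊗ b` (`b = (wᵀ ℓᵥ w)ᵥ`), of rank
  `≤ |ι| + 1`.

In the normal form `Y = diag(0, 1, …, 1)` this is the computation of the route docstring: the
quadratic part of `det (Y + Z)`, `Z` symmetric, is `z₁₁ Σ_{j ≥ 2} z_jj - Σ_{j ≥ 2} z_{1j}²`, of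
rank `m + 1`.
-/

noncomputable section

namespace Summit.ValiantsHypothesis.Theorems

open Literature.Computability.AlgebraicComplexity MvPolynomial Matrix

universe u

variable {k : Type u} [Field k] {ι : Type*} [Fintype ι] [DecidableEq ι]

/-- Entry formula: `(L₁ᵀ H L₂) v v'` is the pairing of column `v` of `L₁` with column `v'` of `L₂`
under the bilinear form `H`. [folklore] -/
theorem transpose_mul_mul_apply {n σ : Type*} [Fintype n] [Fintype σ] (L₁ L₂ : Matrix n σ k)
    (H : Matrix n n k) (v v' : σ) :
    (L₁ᵀ * H * L₂) v v' = (fun p => L₁ p v) ⬝ᵥ H *ᵥ fun p => L₂ p v' := by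
  rw [dotProduct_mulVec]
  simp only [Matrix.mul_apply, transpose_apply, vecMul, dotProduct]

/-- **Transpose invariance of the Hessian of the determinant.** The Hessian of `DET_ι` at the
point `x` and at the transposed point `x ∘ swap` agree after swapping both indices:
`Hess DET (x) (p, q) = Hess DET (x ∘ swap) (p.swap, q.swap)` — the affine chain rule for the
substitution `X_t ↦ X_{t.swap}`, which fixes `DET` (`det Mᵀ = det M`). [folklore] -/
theorem hessianMatrix_detPoly_swap (x : ι × ι → k) (p q : ι × ι) :
    hessianMatrix (detPoly ι k) x p q =
      hessianMatrix (detPoly ι k) (fun t => x t.swap) p.swap q.swap := by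
  set φ : ι × ι → MvPolynomial (ι × ι) k := fun t => X t.swap with hφ
  have hdet : aeval φ (detPoly ι k) = detPoly ι k := by
    have e := mvPolynomialX_mapMatrix_aeval k ((mvPolynomialX ι ι k)ᵀ)
    have hφ' : φ = fun p : ι × ι => (mvPolynomialX ι ι k)ᵀ p.1 p.2 := by
      funext p
      simp [hφ, mvPolynomialX_apply, transpose_apply, Prod.swap]
    rw [detPoly, AlgHom.map_det, hφ', e, det_transpose]
  have hφ2 : ∀ t u v, pderiv u (pderiv v (φ t)) = 0 := by
    intro t u v
    simp only [hφ]
    rw [pderiv_X]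
    by_cases h : t.swap = v
    · simp [h]
    · simp [h]
  have hH := hessianMatrix_aeval_of_affine φ hφ2 (detPoly ι k) x
  rw [hdet] at hH
  have hL : (Matrix.of fun t v => eval x (pderiv v (φ t))) =
      Matrix.of fun (t v : ι × ι) => if t = v.swap then (1 : k) else 0 := by
    ext t v
    simp only [of_apply, hφ]
    rw [pderiv_X]
    by_cases h : t = v.swap
    · subst h
      simp
    · have h' : t.swap ≠ v := fun h' => h (by rw [← h', Prod.swap_swap])
      simp [h, h']
  have hpt : (fun t => eval x (φ t)) = fun t => x t.swap := by
    funext t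
    simp [hφ]
  rw [hL, hpt] at hH
  rw [hH]
  simp only [Matrix.mul_apply, transpose_apply, of_apply, ite_mul, one_mul, zero_mul, mul_ite,
    mul_one, mul_zero, Finset.sum_ite_eq', Finset.mem_univ, if_true]

/-- The pairing `Z₁ᵀ · Hess DET (Y) · Z₂` is unchanged when `Y, Z₁, Z₂` are all transposed
(reindex both sums by `swap` and use `hessianMatrix_detPoly_swap`). [folklore] -/
theorem dotProduct_hessianMatrix_detPoly_mulVec_swap (Y Z₁ Z₂ : Matrix ι ι k) :
    (fun p : ι × ι => Z₁ p.1 p.2) ⬝ᵥ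
        hessianMatrix (detPoly ι k) (fun p => Y p.1 p.2) *ᵥ (fun p : ι × ι => Z₂ p.1 p.2) =
      (fun p : ι × ι => Z₁ p.2 p.1) ⬝ᵥ
        hessianMatrix (detPoly ι k) (fun p => Y p.2 p.1) *ᵥ (fun p : ι × ι => Z₂ p.2 p.1) := by
  simp only [dotProduct, mulVec]
  rw [← (Equiv.prodComm ι ι).sum_comp]
  refine Finset.sum_congr rfl fun p _ => ?_
  simp only [Equiv.prodComm_apply, Prod.fst_swap, Prod.snd_swap]
  congr 1
  rw [← (Equiv.prodComm ι ι).sum_comp]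
  refine Finset.sum_congr rfl fun q _ => ?_
  simp only [Equiv.prodComm_apply, Prod.fst_swap, Prod.snd_swap]
  congr 1
  exact (hessianMatrix_detPoly_swap (fun t : ι × ι => Y t.2 t.1) p q).symm

/-- **Right-kernel version of the tree's vanishing lemma.** If `w ≠ 0`, `Y w = 0` and
`Z₁ w = Z₂ w = 0`, then `Z₁ᵀ · Hess DET (Y) · Z₂ = 0` (transpose everything and apply
`dotProduct_hessianMatrix_detPoly_mulVec_eq_zero`, Mignon–Ressayre 2004, §3). [folklore] -/
theorem dotProduct_hessianMatrix_detPoly_mulVec_eq_zero_of_mulVec (Y Z₁ Z₂ : Matrix ι ι k)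
    (w : ι → k) (hw : w ≠ 0) (hY : Y *ᵥ w = 0) (h₁ : Z₁ *ᵥ w = 0) (h₂ : Z₂ *ᵥ w = 0) :
    (fun p : ι × ι => Z₁ p.1 p.2) ⬝ᵥ
      hessianMatrix (detPoly ι k) (fun p => Y p.1 p.2) *ᵥ (fun p : ι × ι => Z₂ p.1 p.2) = 0 := by
  rw [dotProduct_hessianMatrix_detPoly_mulVec_swap]
  exact dotProduct_hessianMatrix_detPoly_mulVec_eq_zero Yᵀ Z₁ᵀ Z₂ᵀ w hw
    (by rwa [vecMul_transpose]) (by rwa [vecMul_transpose]) (by rwa [vecMul_transpose])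

/-- **Two-sided vanishing.** If `w ≠ 0` is a left AND right null vector of `Y` and of `Z`, and
`wᵀ Z' w = 0`, then `Zᵀ · Hess DET (Y) · Z' = 0`: split `Z' = (Z' - Π Z') + Π Z'` with
`Π Z' = e_{i₀} ⊗ (wᵀ Z') / w_{i₀}`, so that `wᵀ (Z' - Π Z') = 0` (left lemma) and
`(Π Z') w = 0` (right lemma). In the normal form `Y = diag(0,1,…,1)`, `w = e₁`: the quadratic
part `Σ_{j≥2} (z₁₁ z'_jj + z_jj z'₁₁ - z_{1j} z'_{j1} - z_{j1} z'_{1j})` of `det (Y + Z + Z')`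
vanishes when the first row and column of `Z` and the corner `z'₁₁` are zero. [folklore] -/
theorem dotProduct_hessianMatrix_detPoly_mulVec_eq_zero_of_two_sided (Y Z Z' : Matrix ι ι k)
    (w : ι → k) (hw : w ≠ 0) (hYl : w ᵥ* Y = 0) (hYr : Y *ᵥ w = 0) (hZl : w ᵥ* Z = 0)
    (hZr : Z *ᵥ w = 0) (hZ' : w ⬝ᵥ Z' *ᵥ w = 0) :
    (fun p : ι × ι => Z p.1 p.2) ⬝ᵥ
      hessianMatrix (detPoly ι k) (fun p => Y p.1 p.2) *ᵥ (fun p : ι × ι => Z' p.1 p.2) = 0 := by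
  obtain ⟨i₀, hi₀⟩ : ∃ i, w i ≠ 0 := Function.ne_iff.mp hw
  set Z₂ : Matrix ι ι k :=
    Matrix.of fun i j => if i = i₀ then (w i₀)⁻¹ * (w ᵥ* Z') j else 0 with hZ₂
  have h₁ : w ᵥ* (Z' - Z₂) = 0 := by
    ext j
    simp only [vecMul_sub, Pi.sub_apply, Pi.zero_apply]
    rw [sub_eq_zero]
    simp only [hZ₂, vecMul, dotProduct, of_apply, mul_ite, mul_zero, Finset.sum_ite_eq',
      Finset.mem_univ, if_true]
    rw [← mul_assoc, mul_inv_cancel₀ hi₀, one_mul]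
  have h₂ : Z₂ *ᵥ w = 0 := by
    ext i
    simp only [hZ₂, mulVec, dotProduct, of_apply, ite_mul, zero_mul, Pi.zero_apply]
    by_cases hi : i = i₀
    · simp only [hi, if_true, mul_assoc, ← Finset.mul_sum]
      have : ∑ j, (w ᵥ* Z') j * w j = w ⬝ᵥ Z' *ᵥ w := by
        rw [dotProduct_mulVec]; rfl
      rw [this, hZ', mul_zero]
    · simp [hi]
  have hsplit : (fun p : ι × ι => Z' p.1 p.2) =
      (fun p : ι × ι => (Z' - Z₂) p.1 p.2) + fun p : ι × ι => Z₂ p.1 p.2 := by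
    funext p
    simp
  rw [hsplit, mulVec_add, dotProduct_add,
    dotProduct_hessianMatrix_detPoly_mulVec_eq_zero Y Z (Z' - Z₂) w hw hYl hZl h₁,
    dotProduct_hessianMatrix_detPoly_mulVec_eq_zero_of_mulVec Y Z Z₂ w hw hYr hZr h₂, add_zero]

/-- **Abstract form of the symmetric rank bound.** Let `H` be a square matrix on `ι × ι`
(a bilinear form on flattened `ι × ι` matrices) and `w ≠ 0` such that `Zᵀ H Z' = 0` whenever
`wᵀ Z = 0`, `Z w = 0` and `wᵀ Z' w = 0`. Then for every matrix `L` whose columns are (flattened)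
SYMMETRIC matrices, `rank (Lᵀ H L) ≤ |ι| + 1`. Proof: with `u = e_{i₀} / w_{i₀}` the map
`R Z = u (wᵀ Z) + (wᵀ Z)ᵀ uᵀ - (wᵀ Z w) u uᵀ` factors through `Z ↦ wᵀ Z` (rank `≤ |ι|`), takes
symmetric values, and `wᵀ (Z - R Z) = 0`; so for symmetric `Z` the difference `Z - R Z` is
two-sided `w`-orthogonal and, splitting `Z' = (Z' - (wᵀZ'w) u uᵀ) + (wᵀZ'w) u uᵀ`,
`Lᵀ H L = (R L)ᵀ H L + a ⊗ b` with `b_v = wᵀ ℓ_v w` — a matrix of rank `≤ |ι|` plus one of rank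
`≤ 1` (the symmetric replacement for `rank_le_two_mul_card_of_dotProduct_mulVec_eq_zero` of the
tree, Mignon–Ressayre 2004, §3). [folklore] -/
theorem rank_transpose_mul_mul_le_card_add_one (H : Matrix (ι × ι) (ι × ι) k) (w : ι → k)
    (hw : w ≠ 0)
    (hH : ∀ Z Z' : ι × ι → k, w ᵥ* (Matrix.of fun i j => Z (i, j)) = 0 →
      (Matrix.of fun i j => Z (i, j)) *ᵥ w = 0 →
      w ⬝ᵥ (Matrix.of fun i j => Z' (i, j)) *ᵥ w = 0 → Z ⬝ᵥ H *ᵥ Z' = 0)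
    {σ : Type*} [Fintype σ] (L : Matrix (ι × ι) σ k) (hL : ∀ i j v, L (i, j) v = L (j, i) v) :
    (Lᵀ * H * L).rank ≤ Fintype.card ι + 1 := by
  obtain ⟨i₀, hi₀⟩ : ∃ i, w i ≠ 0 := Function.ne_iff.mp hw
  set c : k := (w i₀)⁻¹ with hc
  have hcw : w i₀ * c = 1 := mul_inv_cancel₀ hi₀
  -- `P` flattens `Z ↦ wᵀ Z`; `R = S * P` is the symmetric row/column replacement map.
  set P : Matrix ι (ι × ι) k := Matrix.of fun j q => if q.2 = j then w q.1 else 0 with hP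
  set S : Matrix (ι × ι) ι k := Matrix.of fun p l =>
    (if p.1 = i₀ ∧ l = p.2 then c else 0) + (if p.2 = i₀ ∧ l = p.1 then c else 0) -
      (if p.1 = i₀ ∧ p.2 = i₀ then c ^ 2 * w l else 0) with hS
  set R : Matrix (ι × ι) (ι × ι) k := S * P with hR
  have hPZ : ∀ Z : ι × ι → k, P *ᵥ Z = w ᵥ* (Matrix.of fun i j => Z (i, j)) := by
    intro Z
    ext j
    simp only [hP, mulVec, dotProduct, of_apply, vecMul, ite_mul, zero_mul]
    rw [Fintype.sum_prod_type]
    simp only [Finset.sum_ite_eq', Finset.mem_univ, if_true]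
  have hRZ : ∀ Z : ι × ι → k, R *ᵥ Z = fun p =>
      (if p.1 = i₀ then c * (w ᵥ* Matrix.of fun i j => Z (i, j)) p.2 else 0) +
      (if p.2 = i₀ then c * (w ᵥ* Matrix.of fun i j => Z (i, j)) p.1 else 0) -
      (if p.1 = i₀ ∧ p.2 = i₀ then
        c ^ 2 * ((w ᵥ* Matrix.of fun i j => Z (i, j)) ⬝ᵥ w) else 0) := by
    intro Z
    rw [hR, ← mulVec_mulVec, hPZ]
    set r := w ᵥ* Matrix.of fun i j => Z (i, j) with hr
    ext p
    simp only [hS, mulVec, dotProduct, of_apply, add_mul, sub_mul, Finset.sum_add_distrib,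
      Finset.sum_sub_distrib, ite_mul, zero_mul]
    congr 2
    · by_cases h : p.1 = i₀
      · simp [h]
      · simp [h]
    · by_cases h : p.2 = i₀
      · simp [h]
      · simp [h]
    · by_cases h : p.1 = i₀ ∧ p.2 = i₀
      · simp only [h, and_self, if_true, Finset.mul_sum, mul_assoc, mul_comm (w _) (r _)]
      · simp [h]
  have hRr : R.rank ≤ Fintype.card ι := (rank_mul_le_right S P).trans (rank_le_card_height P)
  -- `R Z` is symmetric for every `Z`
  have hRsymm : ∀ (Z : ι × ι → k) (i j : ι), (R *ᵥ Z) (j, i) = (R *ᵥ Z) (i, j) := by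
    intro Z i j
    rw [hRZ]
    by_cases hi : i = i₀ <;> by_cases hj : j = i₀ <;> simp [hi, hj]
  -- `wᵀ (R Z) = wᵀ Z`
  have hRw : ∀ Z : ι × ι → k,
      w ᵥ* (Matrix.of fun i j => (R *ᵥ Z) (i, j)) = w ᵥ* Matrix.of fun i j => Z (i, j) := by
    intro Z
    ext j
    rw [hRZ]
    set r := w ᵥ* Matrix.of fun i j => Z (i, j) with hr
    rcases eq_or_ne j i₀ with rfl | hj
    · simp only [vecMul, dotProduct, of_apply, and_true, mul_add, mul_sub,
        Finset.sum_add_distrib, Finset.sum_sub_distrib, mul_ite, mul_zero, Finset.sum_ite_eq',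
        Finset.mem_univ, if_true]
      have e1 : ∑ i, w i * (c * r i) = c * ∑ i, r i * w i := by
        rw [Finset.mul_sum]
        exact Finset.sum_congr rfl fun i _ => by ring
      rw [e1]
      linear_combination (r j - c * ∑ i, r i * w i) * hcw
    · simp only [vecMul, dotProduct, of_apply, hj, if_false, and_false, mul_ite, mul_zero,
        add_zero, sub_zero, Finset.sum_ite_eq', Finset.mem_univ, if_true]
      rw [← mul_assoc, hcw, one_mul]
  clear_value R
  -- the fixed matrix `E = u uᵀ` with `wᵀ E w = 1`
  set E : ι × ι → k := fun p => if p.1 = i₀ ∧ p.2 = i₀ then c ^ 2 else 0 with hE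
  have quadE : w ⬝ᵥ (Matrix.of fun i j => E (i, j)) *ᵥ w = 1 := by
    simp only [hE, dotProduct, mulVec, of_apply, ite_mul, zero_mul]
    rw [Finset.sum_eq_single i₀]
    · rw [Finset.sum_eq_single i₀]
      · simp only [and_self, if_true]
        rw [show w i₀ * (c ^ 2 * w i₀) = (w i₀ * c) * (w i₀ * c) by ring, hcw, one_mul]
      · intro j _ hj
        simp [hj]
      · simp
    · intro i _ hi
      simp [hi]
    · simp
  -- linearity of `V ↦ wᵀ V w` in the form we need
  have quad_sub : ∀ (V : ι × ι → k) (t : k),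
      w ⬝ᵥ (Matrix.of fun i j => (V - t • E) (i, j)) *ᵥ w =
        w ⬝ᵥ (Matrix.of fun i j => V (i, j)) *ᵥ w -
          t * (w ⬝ᵥ (Matrix.of fun i j => E (i, j)) *ᵥ w) := by
    intro V t
    have : (Matrix.of fun i j => (V - t • E) (i, j)) =
        (Matrix.of fun i j => V (i, j)) - t • Matrix.of fun i j => E (i, j) := by
      ext i j
      simp
    rw [this, sub_mulVec, dotProduct_sub, smul_mulVec, dotProduct_smul, smul_eq_mul]
  -- columns of `L`, the two vectors of the rank-one correction
  set ℓ : σ → ι × ι → k := fun v p => L p v with hℓ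
  set a : σ → k := fun v => (ℓ v - R *ᵥ ℓ v) ⬝ᵥ H *ᵥ E with ha
  set b : σ → k := fun v => w ⬝ᵥ (Matrix.of fun i j => ℓ v (i, j)) *ᵥ w with hb
  set O : Matrix σ σ k :=
    (Matrix.of fun (v : σ) (_ : Unit) => a v) * Matrix.of fun (_ : Unit) (v' : σ) => b v' with hO
  have hOr : O.rank ≤ 1 := by
    refine (rank_mul_le_right _ _).trans ?_
    simpa using rank_le_card_height (Matrix.of fun (_ : Unit) (v' : σ) => b v')
  have key : Lᵀ * H * L = (R * L)ᵀ * H * L + O := by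
    ext v v'
    rw [Matrix.add_apply, transpose_mul_mul_apply, transpose_mul_mul_apply]
    have hO' : O v v' = a v * b v' := by
      simp [hO, Matrix.mul_apply]
    rw [hO']
    have hRL : (fun p => (R * L) p v) = R *ᵥ ℓ v := by
      funext p
      simp only [Matrix.mul_apply, mulVec, dotProduct, hℓ]
    rw [hRL]
    -- the two-sided orthogonal part of column `v` and the corner-free part of column `v'`
    have hZsymm : ∀ i j, (ℓ v - R *ᵥ ℓ v) (j, i) = (ℓ v - R *ᵥ ℓ v) (i, j) := by
      intro i j
      simp only [Pi.sub_apply, hℓ, hL i j v, hRsymm]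
    have h1 : w ᵥ* (Matrix.of fun i j => (ℓ v - R *ᵥ ℓ v) (i, j)) = 0 := by
      have : (Matrix.of fun i j => (ℓ v - R *ᵥ ℓ v) (i, j)) =
          (Matrix.of fun i j => ℓ v (i, j)) - Matrix.of fun i j => (R *ᵥ ℓ v) (i, j) := by
        ext i j
        simp
      rw [this, vecMul_sub, hRw, sub_self]
    have h2 : (Matrix.of fun i j => (ℓ v - R *ᵥ ℓ v) (i, j)) *ᵥ w = 0 := by
      have hT : (Matrix.of fun i j => (ℓ v - R *ᵥ ℓ v) (i, j))ᵀ =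
          Matrix.of fun i j => (ℓ v - R *ᵥ ℓ v) (i, j) := by
        ext i j
        simp only [transpose_apply, of_apply]
        exact hZsymm i j
      rw [← hT, mulVec_transpose, h1]
    have h3 : w ⬝ᵥ (Matrix.of fun i j => (ℓ v' - b v' • E) (i, j)) *ᵥ w = 0 := by
      rw [quad_sub, quadE, mul_one]
      exact sub_self _
    have h0 := hH (ℓ v - R *ᵥ ℓ v) (ℓ v' - b v' • E) h1 h2 h3
    rw [mulVec_sub, dotProduct_sub, mulVec_smul, dotProduct_smul, smul_eq_mul] at h0
    have hav : (ℓ v - R *ᵥ ℓ v) ⬝ᵥ H *ᵥ E = a v := rfl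
    rw [hav, sub_dotProduct] at h0
    linear_combination h0
  calc (Lᵀ * H * L).rank = ((R * L)ᵀ * H * L + O).rank := by rw [← key]
    _ ≤ ((R * L)ᵀ * H * L).rank + O.rank :=
        Literature.Computability.AlgebraicComplexity.rank_add_le _ _
    _ ≤ (R * L)ᵀ.rank + 1 :=
        add_le_add ((rank_mul_le_left _ _).trans (rank_mul_le_left _ _)) hOr
    _ = (R * L).rank + 1 := by rw [rank_transpose]
    _ ≤ R.rank + 1 := by gcongr; exact rank_mul_le_left _ _
    _ ≤ Fintype.card ι + 1 := by gcongr

/-- **The symmetric Mignon–Ressayre lemma (general field).** If `A` is a SYMMETRIC affine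
determinantal representation of `f` of size `|m|` over a field and `f(x) = 0`, then
`rank Hess f (x) ≤ |m| + 1` (versus `2 |m|` without symmetry,
`rank_hessianMatrix_le_two_mul_of_isAffineDetRepr`). Proof: `Hess f (x) = Lᵀ · Hess DET (A(x)) · L`
by the affine chain rule with the columns of `L` symmetric, `A(x)` is symmetric and singular, and
`rank_transpose_mul_mul_le_card_add_one` applies by
`dotProduct_hessianMatrix_detPoly_mulVec_eq_zero_of_two_sided`. [folklore] -/
theorem rank_hessianMatrix_le_card_add_one_of_isAffineDetRepr_of_isSymm {σ : Type*} [Fintype σ]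
    {f : MvPolynomial σ k} {m : Type*} [Fintype m] [DecidableEq m]
    {A : Matrix m m (MvPolynomial σ k)} (hAs : A.IsSymm) (hA : IsAffineDetRepr f A) (x : σ → k)
    (hx : eval x f = 0) : (hessianMatrix f x).rank ≤ Fintype.card m + 1 := by
  obtain ⟨hdeg, hdet⟩ := hA
  have hf : f = aeval (fun p : m × m => A p.1 p.2) (detPoly m k) := by
    rw [detPoly, AlgHom.map_det, mvPolynomialX_mapMatrix_aeval k A, hdet]
  have hφ : ∀ (t : m × m) (u v : σ), pderiv u (pderiv v (A t.1 t.2)) = 0 := fun t u v =>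
    pderiv_pderiv_eq_zero_of_totalDegree_le_one (hdeg t.1 t.2) u v
  rw [hf, hessianMatrix_aeval_of_affine _ hφ]
  set Y : Matrix m m k := Matrix.of fun i j => eval x (A i j) with hYdef
  have hYdet : Y.det = 0 := by
    have hmap : (MvPolynomial.eval x).mapMatrix A = Y := by
      ext i j; rfl
    rw [← hmap, ← RingHom.map_det, hdet, hx]
  have hYs : Y.IsSymm := Matrix.IsSymm.ext fun i j => by
    simp only [hYdef, of_apply, hAs.apply i j]
  obtain ⟨w, hw, hwY⟩ := Matrix.exists_mulVec_eq_zero_iff.mpr hYdet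
  have hwY' : w ᵥ* Y = 0 := by
    rw [← hYs.eq, vecMul_transpose, hwY]
  refine rank_transpose_mul_mul_le_card_add_one _ w hw (fun Z Z' h1 h2 h3 => ?_) _
    (fun i j v => by simp only [of_apply, hAs.apply i j])
  exact dotProduct_hessianMatrix_detPoly_mulVec_eq_zero_of_two_sided Y
    (Matrix.of fun i j => Z (i, j)) (Matrix.of fun i j => Z' (i, j)) w hw hwY' hwY h1 h2 h3

/-- Settles `stmt-ValiantsHypothesis-5677` (`HessianRankSymmDet`, route `SymPencil`): if
`f = det A` with `A` a symmetric `m × m` matrix of affine linear forms over `ℂ` and `f(x) = 0`,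
then `rank Hess f (x) ≤ m + 1` — `rank_hessianMatrix_le_card_add_one_of_isAffineDetRepr_of_isSymm`
with `|Fin m| = m`. [folklore] -/
theorem hessianRankSymmDet_proof :
    Summit.ValiantsHypothesis.ValiantsHypothesis.Theses.SymPencil.HessianRankSymmDet := by
  unfold Summit.ValiantsHypothesis.ValiantsHypothesis.Theses.SymPencil.HessianRankSymmDet
  intro N _ f x hx m A hAs hA
  simpa using rank_hessianMatrix_le_card_add_one_of_isAffineDetRepr_of_isSymm hAs hA x hx

end Summit.ValiantsHypothesis.Theorems
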